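import Summits.ValiantsHypothesis.ValiantsHypothesis.Theorems.FeketeSOSFeketeSOSHardPaleyRIPDefs
import Mathlib.Algebra.Ring.GeomSum
import Mathlib.Algebra.Polynomial.Coeff
import Mathlib.Tactic.LinearCombination

/-!
# Route FeketeSOS — crux `FeketeSOSHard` (stmt-ValiantsHypothesis-3996), line `paley-rip` v3,
# `stub_tameOperator` piece (B): the dyadic Fejér partition of unity of an interval (algebra)

Piece (B) of the `r = 2` programme for `stub_tameOperator` (`Cruxes/FeketeSOSHard/Lines/paley-rip-stub3-census.md`
§5–§6) asks for the "R_k lemma": flat / exponential patterns on an interval `H = [0,k)` are CHEAP, i.e. the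
all-ones pattern `Σ_{n<2k−1} X^n = π(τ)` has a preimage `τ ∈ Sym_H` of polylogarithmic nuclear norm.  The census
proposed `τ = R_k = (1/r_H(h+h'))_{h,h'<k}` with `‖R_k‖_* = O(log² k)` ASSUMED (two triangularly truncated Hilbert
matrices).  This file replaces that route by an explicit, elementary and sharper identity: a DYADIC FEJÉR
PARTITION OF UNITY.  With the box `B_L = Σ_{i<L} X^i` (so `B_L²/L` is the Fejér triangle `T_L` of height `1`),
the hat functions `T_{2L} − T_L/2` telescope, and for `K = 2^J`

  `K⁻¹ B_K² + Σ_{j<J} 2^{−(j+1)} (B_{2^j}² + (X^{K−2^j} B_{2^j})²) = Σ_{n<2K−1} X^n`   (`flat_dyadic_identity`),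

a positive combination of `2J+1` squares of boxes inside `[0,K)` of total mass `Σ_j |c_j|‖w_j‖₂² = J + 1 =
log₂ K + 1`; for general `k = N + 3·2^J` two polarised trapezoids `L⁻¹ B_L B_M` (`L = 2^{J+1}`, `M = L + N`)
close the middle (`flat_general_identity`, mass `J + 3 + N/2^{J+1} ≤ ⌊log₂ k⌋ + 5/2`).  Everything is
generating-function algebra over `ℂ[X]` (`box_sq : B_K² = D_K + X^K E_K` with the ramp `D_K = Σ (i+1)X^i` and
co-ramp `E_K = Σ (K−1−i) X^i`, `box_mul_box`, and two inductions on `J`).  The representation statements in the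
line's vocabulary (`sqMass`, supports `⊆ range k`) are in `…PaleyRIPIntervalFlat.lean`.

Sharpness (not formalised here): pairing with the dual weight `z = 1/r_H` and Hilbert's inequality
(`‖(1/(a+b+1))_{a,b<k}‖_op ≤ π`) give mass `≥ (ln k)/π − O(1)` for EVERY representation of the flat pattern by
squares supported in `[0,k)`, so `Θ(log k)` is the truth and the `log² k` of the census was lossy.

Honest framing (rung currency): a Theorems-side helper `--supports` stmt-3996; `stub_tameOperator` (r ≥ 2),
the engine `stub_paleyFlatRIP` and the crux `FeketeSOSHard` stay OPEN; `VP ≠ VNP` is untouched.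
-/

set_option linter.dupNamespace false

namespace Summit.ValiantsHypothesis.ValiantsHypothesis.Theorems.FeketeSOSHardPaleyRIP

open Polynomial Finset
open scoped BigOperators

noncomputable section

/-! ## Box, ramp and co-ramp polynomials: generating-function identities -/

/-- `B_{K+1} = B_K + X^K` for the box polynomial `B_K = Σ_{i<K} X^i`. [folklore] -/
theorem box_succ (K : ℕ) :
    (∑ i ∈ range (K + 1), (X : ℂ[X]) ^ i) = (∑ i ∈ range K, (X : ℂ[X]) ^ i) + X ^ K :=
  Finset.sum_range_succ _ _

/-- `B_{a+b} = B_a + X^a B_b`. [folklore] -/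
theorem box_add (a b : ℕ) :
    (∑ i ∈ range (a + b), (X : ℂ[X]) ^ i) =
      (∑ i ∈ range a, (X : ℂ[X]) ^ i) + X ^ a * ∑ i ∈ range b, (X : ℂ[X]) ^ i := by
  rw [Finset.sum_range_add, Finset.mul_sum]
  congr 1
  exact Finset.sum_congr rfl fun i _ => by rw [pow_add]

/-- `X · B_K = B_K + X^K − 1`. [folklore] -/
theorem X_mul_box (K : ℕ) :
    (X : ℂ[X]) * (∑ i ∈ range K, (X : ℂ[X]) ^ i) = (∑ i ∈ range K, (X : ℂ[X]) ^ i) + X ^ K - 1 := by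
  have h : (∑ i ∈ range (K + 1), (X : ℂ[X]) ^ i) = X * (∑ i ∈ range K, (X : ℂ[X]) ^ i) + 1 :=
    geom_sum_succ
  rw [box_succ] at h
  linear_combination -h

/-- Co-ramp recurrence: `E_{K+1} = E_K + B_K`, where `E_K = Σ_{i<K} (K−1−i) X^i`. [folklore] -/
theorem coramp_succ (K : ℕ) :
    (∑ i ∈ range (K + 1), C (((K + 1 : ℕ) : ℂ) - 1 - i) * (X : ℂ[X]) ^ i) =
      (∑ i ∈ range K, C ((K : ℂ) - 1 - i) * (X : ℂ[X]) ^ i) + ∑ i ∈ range K, (X : ℂ[X]) ^ i := by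
  rw [Finset.sum_range_succ, ← Finset.sum_add_distrib]
  have hlast : C (((K + 1 : ℕ) : ℂ) - 1 - (K : ℕ)) * (X : ℂ[X]) ^ K = 0 := by
    push_cast; ring_nf; simp
  rw [hlast, add_zero]
  refine Finset.sum_congr rfl fun i _ => ?_
  push_cast
  rw [show ((K : ℂ) + 1 - 1 - i) = ((K : ℂ) - 1 - i) + 1 by ring, C_add, C_1]
  ring

/-- Ramp recurrence: `D_{K+1} = D_K + (K+1) X^K`, where `D_K = Σ_{i<K} (i+1) X^i`. [folklore] -/
theorem ramp_succ (K : ℕ) :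
    (∑ i ∈ range (K + 1), C ((i : ℂ) + 1) * (X : ℂ[X]) ^ i) =
      (∑ i ∈ range K, C ((i : ℂ) + 1) * (X : ℂ[X]) ^ i) + C ((K : ℂ) + 1) * X ^ K :=
  Finset.sum_range_succ _ _

/-- `(1 − X) E_K = K − B_K`. [folklore] -/
theorem one_sub_X_mul_coramp (K : ℕ) :
    (1 - (X : ℂ[X])) * (∑ i ∈ range K, C ((K : ℂ) - 1 - i) * (X : ℂ[X]) ^ i) =
      C (K : ℂ) - ∑ i ∈ range K, (X : ℂ[X]) ^ i := by
  induction K with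
  | zero => simp
  | succ K ih =>
    rw [coramp_succ, box_succ, mul_add, ih]
    have hx := X_mul_box K
    push_cast
    rw [C_add, C_1]
    linear_combination -hx

/-- `D_K + E_K = K · B_K`. [folklore] -/
theorem ramp_add_coramp (K : ℕ) :
    (∑ i ∈ range K, C ((i : ℂ) + 1) * (X : ℂ[X]) ^ i) +
        (∑ i ∈ range K, C ((K : ℂ) - 1 - i) * (X : ℂ[X]) ^ i) =
      C (K : ℂ) * ∑ i ∈ range K, (X : ℂ[X]) ^ i := by
  rw [← Finset.sum_add_distrib, Finset.mul_sum]
  refine Finset.sum_congr rfl fun i _ => ?_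
  rw [← add_mul, ← C_add]
  congr 2
  ring

/-- **The square of a box is ramp plus shifted co-ramp**: `B_K² = D_K + X^K E_K`
(coefficientwise: `r_K(n) = min(n+1, 2K−1−n)`). [folklore] -/
theorem box_sq (K : ℕ) :
    (∑ i ∈ range K, (X : ℂ[X]) ^ i) ^ 2 =
      (∑ i ∈ range K, C ((i : ℂ) + 1) * (X : ℂ[X]) ^ i) +
        X ^ K * ∑ i ∈ range K, C ((K : ℂ) - 1 - i) * (X : ℂ[X]) ^ i := by
  induction K with
  | zero => simp
  | succ K ih =>
    rw [coramp_succ, ramp_succ, box_succ]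
    have hf := one_sub_X_mul_coramp K
    have hx := X_mul_box K
    rw [C_add, C_1]
    linear_combination ih + (X : ℂ[X]) ^ K * hf - (X : ℂ[X]) ^ K * hx

/-- **Box times box**: `B_L B_N + E_L = L · B_N + X^N E_L`. [folklore] -/
theorem box_mul_box (L N : ℕ) :
    (∑ i ∈ range L, (X : ℂ[X]) ^ i) * (∑ i ∈ range N, (X : ℂ[X]) ^ i) +
        (∑ i ∈ range L, C ((L : ℂ) - 1 - i) * (X : ℂ[X]) ^ i) =
      C (L : ℂ) * (∑ i ∈ range N, (X : ℂ[X]) ^ i) +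
        X ^ N * ∑ i ∈ range L, C ((L : ℂ) - 1 - i) * (X : ℂ[X]) ^ i := by
  induction N with
  | zero => simp
  | succ N ih =>
    rw [box_succ]
    have hf := one_sub_X_mul_coramp L
    linear_combination ih + (X : ℂ[X]) ^ N * hf

/-- Co-ramp of a sum of lengths: `E_{a+b} = E_a + b · B_a + X^a E_b`. [folklore] -/
theorem coramp_add (a b : ℕ) :
    (∑ i ∈ range (a + b), C (((a + b : ℕ) : ℂ) - 1 - i) * (X : ℂ[X]) ^ i) =
      (∑ i ∈ range a, C ((a : ℂ) - 1 - i) * (X : ℂ[X]) ^ i) + C (b : ℂ) * (∑ i ∈ range a, (X : ℂ[X]) ^ i) +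
        X ^ a * ∑ i ∈ range b, C ((b : ℂ) - 1 - i) * (X : ℂ[X]) ^ i := by
  rw [Finset.sum_range_add, Finset.mul_sum, Finset.mul_sum, ← Finset.sum_add_distrib]
  congr 1
  · refine Finset.sum_congr rfl fun i _ => ?_
    rw [← add_mul, ← C_add]
    congr 2
    push_cast; ring
  · refine Finset.sum_congr rfl fun i _ => ?_
    have h : (((a + b : ℕ) : ℂ) - 1 - ((a + i : ℕ) : ℂ)) = ((b : ℂ) - 1 - i) := by push_cast; ring
    rw [pow_add, h]
    ring


/-! ## The dyadic Fejér partition of unity -/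

/-- **Left dyadic identity.**  With `K = 2^J`:
`Σ_{j<J} 2^{-(j+1)} B_{2^j}² + K⁻¹ B_K² = B_K + K⁻¹ X^K E_K` — the hat functions `T_{2L} − T_L/2` telescope
(`T_L = B_L²/L` is the Fejér triangle): the left side is `1` on `[0, K)` and the ramp `(K−1−i)/K` on `K + i`. [folklore] -/
theorem dyadic_left (J : ℕ) :
    (∑ j ∈ range J, C (((2 ^ (j + 1) : ℕ) : ℂ)⁻¹) * (∑ i ∈ range (2 ^ j), (X : ℂ[X]) ^ i) ^ 2) +
        C (((2 ^ J : ℕ) : ℂ)⁻¹) * (∑ i ∈ range (2 ^ J), (X : ℂ[X]) ^ i) ^ 2 =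
      (∑ i ∈ range (2 ^ J), (X : ℂ[X]) ^ i) +
        C (((2 ^ J : ℕ) : ℂ)⁻¹) * X ^ (2 ^ J) *
          ∑ i ∈ range (2 ^ J), C (((2 ^ J : ℕ) : ℂ) - 1 - i) * (X : ℂ[X]) ^ i := by
  induction J with
  | zero => simp
  | succ J ih =>
    rw [Finset.sum_range_succ]
    have hK0 : ((2 ^ J : ℕ) : ℂ) ≠ 0 := Nat.cast_ne_zero.2 (pow_pos two_pos J).ne'
    have h2 : 2 ^ (J + 1) = 2 ^ J + 2 ^ J := by rw [pow_succ]; ring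
    rw [h2]
    set K : ℕ := 2 ^ J with hK
    rw [box_add K K, coramp_add K K, pow_add]
    have hsq := box_sq K
    have hDE := ramp_add_coramp K
    have hCu : C ((K : ℂ)⁻¹) * C (K : ℂ) = (1 : ℂ[X]) := by
      rw [← C_mul, inv_mul_cancel₀ hK0, C_1]
    have hv2 : C ((K : ℂ)⁻¹) = (2 : ℂ[X]) * C (((K + K : ℕ) : ℂ)⁻¹) := by
      rw [show (2 : ℂ[X]) = C (2 : ℂ) from rfl, ← C_mul]
      congr 1
      push_cast
      field_simp
      ring
    set B := ∑ i ∈ range K, (X : ℂ[X]) ^ i with hB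
    set E := ∑ i ∈ range K, C ((K : ℂ) - 1 - i) * (X : ℂ[X]) ^ i with hE
    set D := ∑ i ∈ range K, C ((i : ℂ) + 1) * (X : ℂ[X]) ^ i with hD
    set u := C ((K : ℂ)⁻¹) with hu
    set v := C (((K + K : ℕ) : ℂ)⁻¹) with hv
    set c := C (K : ℂ) with hc
    linear_combination ih + (-(B ^ 2) + X ^ K * E - X ^ K * B * c) * hv2 +
      (v * (2 * X ^ K + (X ^ K) ^ 2)) * hsq + (v * (2 * X ^ K + (X ^ K) ^ 2)) * hDE + (X ^ K * B) * hCu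

/-- **Right dyadic identity** (mirror image of `dyadic_left`).  With `K = 2^J`:
`Σ_{j<J} 2^{-(j+1)} (X^{K−2^j} B_{2^j})² = X^K (B_{K−1} − K⁻¹ E_K)`. [folklore] -/
theorem dyadic_right (J : ℕ) :
    (∑ j ∈ range J, C (((2 ^ (j + 1) : ℕ) : ℂ)⁻¹) *
        (X ^ (2 ^ J - 2 ^ j) * ∑ i ∈ range (2 ^ j), (X : ℂ[X]) ^ i) ^ 2) =
      X ^ (2 ^ J) * ((∑ i ∈ range (2 ^ J - 1), (X : ℂ[X]) ^ i) -
        C (((2 ^ J : ℕ) : ℂ)⁻¹) * ∑ i ∈ range (2 ^ J), C (((2 ^ J : ℕ) : ℂ) - 1 - i) * (X : ℂ[X]) ^ i) := by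
  induction J with
  | zero => simp
  | succ J ih =>
    rw [Finset.sum_range_succ]
    have hK0 : ((2 ^ J : ℕ) : ℂ) ≠ 0 := Nat.cast_ne_zero.2 (pow_pos two_pos J).ne'
    have hK1 : 1 ≤ 2 ^ J := Nat.one_le_two_pow
    -- reindex the old summands: `X^{2K − 2^j} = X^K · X^{K − 2^j}`
    have hre : (∑ j ∈ range J, C (((2 ^ (j + 1) : ℕ) : ℂ)⁻¹) *
        (X ^ (2 ^ (J + 1) - 2 ^ j) * ∑ i ∈ range (2 ^ j), (X : ℂ[X]) ^ i) ^ 2) =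
        X ^ (2 ^ J + 2 ^ J) * ∑ j ∈ range J, C (((2 ^ (j + 1) : ℕ) : ℂ)⁻¹) *
          (X ^ (2 ^ J - 2 ^ j) * ∑ i ∈ range (2 ^ j), (X : ℂ[X]) ^ i) ^ 2 := by
      rw [Finset.mul_sum]
      refine Finset.sum_congr rfl fun j hj => ?_
      have hj' : 2 ^ j ≤ 2 ^ J := Nat.pow_le_pow_right two_pos (mem_range.1 hj).le
      have hexp : 2 ^ (J + 1) - 2 ^ j = 2 ^ J + (2 ^ J - 2 ^ j) := by rw [pow_succ]; omega
      rw [hexp, pow_add]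
      ring
    rw [hre, ih]
    have h2 : 2 ^ (J + 1) = 2 ^ J + 2 ^ J := by rw [pow_succ]; ring
    rw [h2]
    set K : ℕ := 2 ^ J with hK
    have hKK : K + K - K = K := Nat.add_sub_cancel K K
    have hKK1 : K + K - 1 = K + (K - 1) := by omega
    rw [hKK, hKK1, box_add K (K - 1), coramp_add K K]
    have hsq := box_sq K
    have hDE := ramp_add_coramp K
    have hCu : C ((K : ℂ)⁻¹) * C (K : ℂ) = (1 : ℂ[X]) := by
      rw [← C_mul, inv_mul_cancel₀ hK0, C_1]
    have hv2 : C ((K : ℂ)⁻¹) = (2 : ℂ[X]) * C (((K + K : ℕ) : ℂ)⁻¹) := by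
      rw [show (2 : ℂ[X]) = C (2 : ℂ) from rfl, ← C_mul]
      congr 1
      push_cast
      field_simp
      ring
    set B := ∑ i ∈ range K, (X : ℂ[X]) ^ i with hB
    set B' := ∑ i ∈ range (K - 1), (X : ℂ[X]) ^ i with hB'
    set E := ∑ i ∈ range K, C ((K : ℂ) - 1 - i) * (X : ℂ[X]) ^ i with hE
    set D := ∑ i ∈ range K, C ((i : ℂ) + 1) * (X : ℂ[X]) ^ i with hD
    set u := C ((K : ℂ)⁻¹) with hu
    set v := C (((K + K : ℕ) : ℂ)⁻¹) with hv
    set c := C (K : ℂ) with hc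
    linear_combination (v * X ^ (K + K)) * hsq + (v * X ^ (K + K)) * hDE +
      (X ^ (K + K) * B) * hCu + (-(X ^ (K + K)) * (c * B + X ^ K * E)) * hv2

/-- **Flat interval pattern, `k = 2^J` (exact dyadic Fejér partition of unity).**
`K⁻¹ B_K² + Σ_{j<J} 2^{-(j+1)} (B_{2^j}² + (X^{K−2^j} B_{2^j})²) = Σ_{n<2K−1} X^n`:
the all-ones pattern on `[0, 2K−1)` is a positive combination of `2J+1` squares of boxes inside `[0, K)`. [folklore] -/
theorem flat_dyadic_identity (J : ℕ) :
    C (((2 ^ J : ℕ) : ℂ)⁻¹) * (∑ i ∈ range (2 ^ J), (X : ℂ[X]) ^ i) ^ 2 +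
        ∑ j ∈ range J, C (((2 ^ (j + 1) : ℕ) : ℂ)⁻¹) *
          ((∑ i ∈ range (2 ^ j), (X : ℂ[X]) ^ i) ^ 2 +
            (X ^ (2 ^ J - 2 ^ j) * ∑ i ∈ range (2 ^ j), (X : ℂ[X]) ^ i) ^ 2) =
      ∑ n ∈ range (2 * 2 ^ J - 1), (X : ℂ[X]) ^ n := by
  have hl := dyadic_left J
  have hr := dyadic_right J
  have hK1 : 1 ≤ 2 ^ J := Nat.one_le_two_pow
  have h : 2 * 2 ^ J - 1 = 2 ^ J + (2 ^ J - 1) := by omega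
  rw [h, box_add]
  simp_rw [mul_add, Finset.sum_add_distrib]
  linear_combination hl + hr

/-- **Flat interval pattern, general length** (`k = N + 3·2^J`, any `N`).  With `a = 2^J`, `L = 2a`,
`M = N + 2a`: the `2(J+1)` dyadic Fejér squares at both ends plus two trapezoids
`L⁻¹ B_L B_M = (4L)⁻¹((B_L + B_M)² − (X^L B_N)²)` (and its mirror image) give the all-ones pattern on
`[0, 2k−1)` from squares supported in `[0, k)`. [folklore] -/
theorem flat_general_identity (J N : ℕ) :
    (∑ j ∈ range (J + 1), C (((2 ^ (j + 1) : ℕ) : ℂ)⁻¹) *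
        ((∑ i ∈ range (2 ^ j), (X : ℂ[X]) ^ i) ^ 2 +
          (X ^ (N + 2 ^ J + (2 ^ (J + 1) - 2 ^ j)) * ∑ i ∈ range (2 ^ j), (X : ℂ[X]) ^ i) ^ 2)) +
      C ((4 * ((2 ^ (J + 1) : ℕ) : ℂ))⁻¹) *
        (((∑ i ∈ range (2 ^ (J + 1)), (X : ℂ[X]) ^ i) +
              ∑ i ∈ range (2 ^ (J + 1) + N), (X : ℂ[X]) ^ i) ^ 2 -
            (X ^ (2 ^ (J + 1)) * ∑ i ∈ range N, (X : ℂ[X]) ^ i) ^ 2 +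
          (X ^ (N + 2 ^ J) * (∑ i ∈ range (2 ^ (J + 1)), (X : ℂ[X]) ^ i) +
              X ^ (2 ^ J) * ∑ i ∈ range (2 ^ (J + 1) + N), (X : ℂ[X]) ^ i) ^ 2 -
            (X ^ (2 ^ J) * ∑ i ∈ range N, (X : ℂ[X]) ^ i) ^ 2) =
      ∑ n ∈ range (2 * (N + 3 * 2 ^ J) - 1), (X : ℂ[X]) ^ n := by
  have hl := dyadic_left (J + 1)
  have hr := dyadic_right (J + 1)
  simp_rw [mul_add]
  rw [Finset.sum_add_distrib]
  -- reindex the mirrored dyadic squares: `X^{k − 2^j} = X^{N+a} · X^{2a − 2^j}`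
  have hre : (∑ j ∈ range (J + 1), C (((2 ^ (j + 1) : ℕ) : ℂ)⁻¹) *
      (X ^ (N + 2 ^ J + (2 ^ (J + 1) - 2 ^ j)) * ∑ i ∈ range (2 ^ j), (X : ℂ[X]) ^ i) ^ 2) =
      X ^ (N + 2 ^ J) * X ^ (N + 2 ^ J) * ∑ j ∈ range (J + 1), C (((2 ^ (j + 1) : ℕ) : ℂ)⁻¹) *
        (X ^ (2 ^ (J + 1) - 2 ^ j) * ∑ i ∈ range (2 ^ j), (X : ℂ[X]) ^ i) ^ 2 := by
    rw [Finset.mul_sum]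
    refine Finset.sum_congr rfl fun j _ => ?_
    rw [pow_add]
    ring
  rw [hre, hr]
  have hL0 : ((2 ^ (J + 1) : ℕ) : ℂ) ≠ 0 := Nat.cast_ne_zero.2 (pow_pos two_pos (J + 1)).ne'
  have ha1 : 1 ≤ 2 ^ J := Nat.one_le_two_pow
  have h2 : 2 ^ (J + 1) = 2 ^ J + 2 ^ J := by rw [pow_succ]; ring
  rw [h2] at hl hL0 ⊢
  set a : ℕ := 2 ^ J with ha
  have hlen : 2 * N + 2 * (3 * a) - 1 = (a + a + N) + ((a + a + N) + (a + a - 1)) := by omega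
  rw [hlen, box_add (a + a + N), box_add (a + a + N)]
  have hM1 := box_add (a + a) N
  have hM2 : (∑ i ∈ range (a + a + N), (X : ℂ[X]) ^ i) =
      (∑ i ∈ range N, (X : ℂ[X]) ^ i) + X ^ N * ∑ i ∈ range (a + a), (X : ℂ[X]) ^ i := by
    rw [show a + a + N = N + (a + a) by ring]; exact box_add N (a + a)
  have hg1 := box_mul_box (a + a) N
  have hg2 := box_mul_box (a + a) (a + a + N)
  have hvc : C (((a + a : ℕ) : ℂ)⁻¹) * C ((a + a : ℕ) : ℂ) = (1 : ℂ[X]) := by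
    rw [← C_mul, inv_mul_cancel₀ hL0, C_1]
  have hq : C (((a + a : ℕ) : ℂ)⁻¹) = (4 : ℂ[X]) * C ((4 * ((a + a : ℕ) : ℂ))⁻¹) := by
    rw [show (4 : ℂ[X]) = C (4 : ℂ) from rfl, ← C_mul]
    congr 1
    field_simp
  set BL := ∑ i ∈ range (a + a), (X : ℂ[X]) ^ i with hBL
  set BM := ∑ i ∈ range (a + a + N), (X : ℂ[X]) ^ i with hBM
  set BN := ∑ i ∈ range N, (X : ℂ[X]) ^ i with hBN
  set BL1 := ∑ i ∈ range (a + a - 1), (X : ℂ[X]) ^ i with hBL1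
  set EL := ∑ i ∈ range (a + a), C (((a + a : ℕ) : ℂ) - 1 - i) * (X : ℂ[X]) ^ i with hEL
  set v := C (((a + a : ℕ) : ℂ)⁻¹) with hv
  set c := C ((a + a : ℕ) : ℂ) with hc
  set q := C ((4 * ((a + a : ℕ) : ℂ))⁻¹) with hq'
  linear_combination hl +
    (q * (BM - BL + X ^ (a + a) * BN) + v * BL - 1) * hM1 +
    (q * X ^ a * (X ^ a * BM - X ^ (N + a) * BL + X ^ a * BN)) * hM2 +
    (-(BL * BM) * (1 + X ^ (N + a + a))) * hq + (v * X ^ (a + a)) * hg1 + (v * X ^ (a + a + N)) * hg2 +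
    (X ^ (a + a) * BN + X ^ (a + a + N) * BM) * hvc

end

end Summit.ValiantsHypothesis.ValiantsHypothesis.Theorems.FeketeSOSHardPaleyRIP
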